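import Summits.QuantumAdvantage.AdviceFreeQNC0.MassInequalityK
import HarnessLib

/-!
# Cell qa-qnc0 (rung F-Q1, density axis, crux of record `TensorMultOneAt`): `LightMassK m` for every `m`
# — the light-deviation lemma at EVERY LEVEL (planner qa-qnc0-p1 Sketch13 v6b, ask P18″)

`LightMassK m` (statement VERBATIM in `MassInequalityK.lean`): support concentration `SC1At m K0` ⇒ for
every `k ≥ 1`, every level-`(k+1)` deviation `D` with codeword columns (`ColsInCK`) that is ROW-LIGHT
w.r.t. the `k`-block sum code `S_k` (`RowLightK`: every row has less than half the weight of every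
non-zero word of `S_k`) has a non-negative mass bracket `bracketK m k K0 D ≥ 0`.  Proof = qn-lit's
`lightMass` (level one, `LightDeviation.lean`) with `distTo S_k` for `distC`: row-lightness forces
`d(D u, S_k) = pwt (D u)` (`distTo_eq_pwt_of_light`: `0 ∈ S_k`, and a non-zero `Q ∈ S_k` is at distance
`≥ pwt Q − pwt (D u) > pwt (D u)`), the bracket becomes `Σ_{u ∉ Z} pwt(D u) − Σ_{u ∈ Z} pwt(D u)`, and
double counting by contexts `v` turns it into `Σ_v (|A_v ∖ Z| − |A_v ∩ Z|) ≥ 0`, `A_v = D(·)(v)` a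
codeword, by `SC1At` columnwise.

* **`lightMassK : ∀ m, LightMassK m`**.

The cell's lemma (not in print).  WHAT THIS IS NOT: nothing beyond the light cone (the far regime of
`MassIneqAll` is OPEN); nothing on α; separation NOT moved.
-/

noncomputable section

namespace Summit.QuantumAdvantage.AdviceFreeQNC0

open Finset
open MassInequality

namespace LightK

variable {m k : ℕ}

/-- Under row-lightness the distance of a row to the sum code is its weight. -/
theorem distTo_eq_pwt_of_light {r : (Fin (m * k) → Bool) → Bool}
    (hlight : ∀ Q, SumCodeWin (m * k) k 1 Q → pwt Q ≠ 0 → 2 * pwt r < pwt Q) :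
    distTo (SumCodeWin (m * k) k 1) r = pwt r := by
  apply le_antisymm
  · rw [← pdist_false r]; exact distTo_le (sumCode_false m k)
  · obtain ⟨Q, hQ, hQd⟩ := exists_eq_distTo ⟨_, sumCode_false m k⟩ r
    rw [← hQd]
    by_cases h0 : pwt Q = 0
    · have hQ0 : Q = fun _ => false := by
        funext v
        by_contra hv
        have hv' : Q v = true := by cases h : Q v <;> simp_all
        have : 0 < pwt Q := by
          unfold pwt; exact card_pos.2 ⟨v, by simp [hv']⟩
        omega
      rw [hQ0, pdist_false]
    · have h1 := hlight Q hQ h0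
      have h2 := pwt_le_pwt_add_pdist r Q
      omega

/-- Double counting over contexts: `Σ_{u : K0 u = b} pwt (D u) = Σ_v #{u : D u v ∧ K0 u = b}`. -/
theorem sum_pwt_eq_sum_ctx (K0 : (Fin m → Bool) → Bool) (D : (Fin m → Bool) → (Fin (m * k) → Bool) → Bool)
    (b : Bool) :
    ∑ u ∈ univ.filter (fun u : Fin m → Bool => K0 u = b), pwt (D u) =
      ∑ v : Fin (m * k) → Bool, (univ.filter fun u : Fin m → Bool => D u v = true ∧ K0 u = b).card := by
  classical
  have hrow : ∀ u : Fin m → Bool, pwt (D u) = ∑ v : Fin (m * k) → Bool, if D u v = true then 1 else 0 := by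
    intro u; unfold pwt; rw [Finset.card_filter]
  have hcol : ∀ v : Fin (m * k) → Bool,
      (univ.filter fun u : Fin m → Bool => D u v = true ∧ K0 u = b).card =
        ∑ u ∈ univ.filter (fun u : Fin m → Bool => K0 u = b), if D u v = true then 1 else 0 := by
    intro v
    rw [Finset.sum_filter, Finset.card_filter]
    refine Finset.sum_congr rfl fun u _ => ?_
    by_cases h1 : D u v = true <;> by_cases h2 : K0 u = b <;> simp [h1, h2]
  simp_rw [hrow, hcol]
  exact Finset.sum_comm

end LightK

open LightK

/-- **`LightMassK m` for every `m` — PROVED** (planner qa-qnc0-p1 Sketch13 v6b, ask P18″). -/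
theorem lightMassK (m : ℕ) : LightMassK m := by
  classical
  intro K0 hSC k _ D hcols hlight
  unfold bracketK
  have hdist : ∀ u, distTo (SumCodeWin (m * k) k 1) (D u) = pwt (D u) :=
    fun u => distTo_eq_pwt_of_light (hlight u)
  simp only [hdist]
  rw [← Nat.cast_sum, ← Nat.cast_sum, sum_pwt_eq_sum_ctx K0 D true, sum_pwt_eq_sum_ctx K0 D false,
    sub_nonneg, Nat.cast_le]
  exact sum_le_sum fun v _ => hSC (fun u => D u v) (hcols v)

end Summit.QuantumAdvantage.AdviceFreeQNC0
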